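import Summits.CriticalPhenomena.PercolationContinuityZ3.Theorems.PercNearOneGluingNoHeavyLowerTailSunflowerMultiPetalKempeMarkedPatterns
import Summits.CriticalPhenomena.PercolationContinuityZ3.Theorems.PercNearOneGluingNoHeavyLowerTailSunflowerMultiPetalKempeMarkedSwap
import HarnessLib
import HarnessLib.Audit

/-!
# `NoHeavyLowerTail` (crux stmt-CriticalPhenomena-4575), marked-multigraph layer: the PAYER CELLS of the neighbourhood-contraction charging

Support file (seat `prim-l12-p2` gen 47; `--supports stmt-CriticalPhenomena-4575`; continuation of `…KempeMarkedPatterns` (p595736) and `…KempeMarkedSwap`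
(p595260)).  No `sorry`; nothing is asserted about the crux.  Memo: run/shared/lean/prim/prim-l12/prim-l12-p2/FINDING-g47-NEIGHBOURHOOD-CONTRACTION-STEP.md §3 STEP 2.

For terminals `u ≠ v`, an unmarked non-terminal `y ∼ u`, `S = N(y) ∖ {u,v}`, and a deficit cell `ρ` (p595736 `resCell_neg_cases`), the designated payer cell
has residual `2` (`≥ 1` for P5 when `|S| = 2`), computed from the swap identities on `K.isolate y` (`ctypeM_isolate_phiU_of_001`) and the one-point
splitting at the exceptional vertex `s₀` (`cntM_isolate_update`):
* `resCell_phiU_of_D1` — P1 = `Φ_u ρ` (all of `S` coloured `0`): residual `kerTAbs t (2,0,0) − fC t = 2` at `t = (≥1,0,0)`;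
* `resCell_phiU_of_D2` — P2 = `Φ_u ρ` (all of `S` coloured `1`): `kerTAbs (≥1,0,0) (1,2,0) = 2`;
* `resCell_sibling_of_D4` — P4 = `ρ[s₀ ↦ 1]` (same row): `kerTAbs (0,≥1,0) (2,1,0) = 2`;
* `one_le_resCell_partner_of_D5` — P5 = `(Φ_u ρ)[s₀ ↦ 0]`: `kerTAbs (≥1,0,0) (2,0,≥1) ≥ 1`.
-/

namespace Summit.CriticalPhenomena.PercolationContinuityZ3.Theorems.SunflowerPartition.Kempe

open Finset

namespace MGraph

variable {V : Type*} [Fintype V] [LinearOrder V] (K : MGraph V)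

/-! ## Charging: payer cells of the four deficit families -/

section Charging

variable {K}
variable {u v y : V} {S : Finset V}

/-- Finite payer table for P5 with a possibly small `S`: `1 ≤ kerTAbs (a,0,0) (2,0,c)` for `a, c ≠ 0`. (finite check) [this work] -/
theorem one_le_kerTAbs_two_zero_pos : ∀ a c : Fin 3, a ≠ 0 → c ≠ 0 → 1 ≤ kerTAbs (a, 0, 0) (2, 0, c) := by decide

/-- `2 ≤ n ↔ cap3 n = 2`. [this work] -/
theorem two_le_iff_cap3 (n : ℕ) : 2 ≤ n ↔ cap3 n = 2 := by
  unfold cap3; rw [Fin.ext_iff]; simp only [Fin.val_two]; omega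

/-- The type of `Φ_u ρ` in `K − y` when `ρ` has type `(0,0,1)` there: `(a, 0, 0)` with `a ≠ 0` (swap identities of `…KempeMarkedSwap` for `K.isolate y`). [this work] -/
theorem ctypeM_isolate_phiU_of_001 (ρ : V → Fin 3) (hu : ρ u = 0) (ht : (K.isolate y).ctypeM ρ = (0, 0, 1)) :
    ((K.isolate y).ctypeM (phiU u ρ)).2.1 = 0 ∧ ((K.isolate y).ctypeM (phiU u ρ)).2.2 = 0 ∧ ((K.isolate y).ctypeM (phiU u ρ)).1 ≠ 0 := by
  unfold ctypeM at ht ⊢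
  simp only [Prod.mk.injEq] at ht
  obtain ⟨h0, h1, h2⟩ := ht
  have c0 : (K.isolate y).cntM ρ 0 = 0 := (eq_zero_iff_cap3 _).2 h0
  have c1 : (K.isolate y).cntM ρ 1 = 0 := (eq_zero_iff_cap3 _).2 h1
  have c2 : (K.isolate y).cntM ρ 2 = 1 := (eq_one_iff_cap3 _).2 h2
  have e1 := (K.isolate y).cntM_phiU_one u ρ hu
  have e2 := (K.isolate y).cntM_phiU_two u ρ hu
  have e0 := (K.isolate y).cntM_phiU_zero u ρ hu
  refine ⟨(eq_zero_iff_cap3 _).1 (by rw [e1, c1]), (eq_zero_iff_cap3 _).1 (by omega), fun h => ?_⟩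
  have := (eq_zero_iff_cap3 _).2 h
  omega

/-- **Payer P1**: for a D1 cell (`S ≡ 2`, `mul y v = 0`, type `001`), the cell `Φ_u ρ` (all of `S` coloured `0`) has residual `2`. [this work] -/
theorem resCell_phiU_of_D1 (hS : ∀ w, w ∈ S ↔ (w ≠ u ∧ w ≠ v ∧ w ≠ y ∧ K.mul y w ≠ 0)) (huv : u ≠ v) (hyu : y ≠ u) (hyv : y ≠ v)
    (hmy : K.mark y = 0) (hyu' : K.mul y u ≠ 0) (hne : S.Nonempty) (ρ : V → Fin 3) (hu : ρ u = 0) (hv : ρ v = 1)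
    (hall : ∀ s ∈ S, ρ s = 2) (hyv' : K.mul y v = 0) (ht : (K.isolate y).ctypeM ρ = (0, 0, 1)) :
    K.resCell y S (phiU u ρ) = 2 := by
  have hu' : phiU u ρ u = 0 := by rw [phiU_self, hu]
  have hv' : phiU u ρ v = 1 := by rw [phiU_of_ne u ρ huv.symm, hv]; decide
  have huS : u ∉ S := fun h => ((hS u).1 h).1 rfl
  have hall' : ∀ s ∈ S, phiU u ρ s = 0 := fun s hs => by
    rw [phiU_of_ne u ρ (fun h => huS (h ▸ hs)), hall s hs]; decide
  obtain ⟨tb, tc, ta⟩ := ctypeM_isolate_phiU_of_001 ρ hu ht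
  have hprof := profM_allZero hS huv hyu hyv hmy hyu' hne (phiU u ρ) hu' hv' hall'
  -- the profile is (2, 0, 0): its middle coordinate is cap (mul y v + Σ_S [·=1]) = 0
  have hmid : (K.profM y (phiU u ρ)).2.1 = 0 := by
    unfold profM
    simp only [hmy, add_zero]
    rw [linkM_eq_outer hS huv hyu hyv (phiU u ρ) 1, if_neg (by rw [hu']; decide), if_pos hv', hyv',
      sum_eq_zero (fun s hs => by rw [hall' s hs]; simp)]
    rfl
  have hk : K.profM y (phiU u ρ) = (2, 0, 0) := Prod.ext hprof.1 (Prod.ext hmid hprof.2)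
  unfold resCell
  rw [if_pos hall', hk, kerTAbs_sub_fC_two_zero_zero, if_pos ⟨tb, tc⟩]

/-- **Payer P2**: for a D2 cell (`S ≡ 1`, `mul y u = 1`, type `001`), the cell `Φ_u ρ` (S still `1`) has residual `2`. [this work] -/
theorem resCell_phiU_of_D2 (hS : ∀ w, w ∈ S ↔ (w ≠ u ∧ w ≠ v ∧ w ≠ y ∧ K.mul y w ≠ 0)) (huv : u ≠ v) (hyu : y ≠ u) (hyv : y ≠ v)
    (hmy : K.mark y = 0) (htwo : 2 ≤ S.card) (ρ : V → Fin 3) (hu : ρ u = 0) (hv : ρ v = 1)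
    (hall : ∀ s ∈ S, ρ s = 1) (hyu1 : K.mul y u = 1) (ht : (K.isolate y).ctypeM ρ = (0, 0, 1)) :
    K.resCell y S (phiU u ρ) = 2 := by
  have hu' : phiU u ρ u = 0 := by rw [phiU_self, hu]
  have hv' : phiU u ρ v = 1 := by rw [phiU_of_ne u ρ huv.symm, hv]; decide
  have huS : u ∉ S := fun h => ((hS u).1 h).1 rfl
  have hall' : ∀ s ∈ S, phiU u ρ s = 1 := fun s hs => by
    rw [phiU_of_ne u ρ (fun h => huS (h ▸ hs)), hall s hs]; decide
  have hne : S.Nonempty := card_pos.1 (by omega)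
  have hnot : ¬(∀ s ∈ S, phiU u ρ s = 0) := by
    obtain ⟨s, hs⟩ := hne; intro hh; have := hh s hs; rw [hall' s hs] at this; exact absurd this (by decide)
  obtain ⟨tb, tc, ta⟩ := ctypeM_isolate_phiU_of_001 ρ hu ht
  have hA0 : (∑ s ∈ S, (if phiU u ρ s = 0 then K.mul y s else 0)) = 0 :=
    sum_eq_zero fun s hs => by rw [hall' s hs]; simp
  have hA2 : (∑ s ∈ S, (if phiU u ρ s = 2 then K.mul y s else 0)) = 0 :=
    sum_eq_zero fun s hs => by rw [hall' s hs]; simp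
  have hge := card_le_sumS hS (phiU u ρ) 1 hall'
  have hk : K.profM y (phiU u ρ) = (1, 2, 0) := by
    unfold profM
    simp only [hmy, add_zero]
    rw [linkM_eq_outer hS huv hyu hyv (phiU u ρ) 0, linkM_eq_outer hS huv hyu hyv (phiU u ρ) 1, linkM_eq_outer hS huv hyu hyv (phiU u ρ) 2,
      if_pos hu', if_neg (by rw [hv']; decide), if_neg (by rw [hu']; decide), if_pos hv', if_neg (by rw [hu']; decide), if_neg (by rw [hv']; decide),
      hA0, hA2]
    refine Prod.ext ?_ (Prod.ext ?_ ?_)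
    · simp only [add_zero, hyu1]; rfl
    · simp only [zero_add]; exact (two_le_iff_cap3 _).1 (by omega)
    · rfl
  have htrip : (K.isolate y).ctypeM (phiU u ρ) = (((K.isolate y).ctypeM (phiU u ρ)).1, 0, 0) := Prod.ext rfl (Prod.ext tb tc)
  unfold resCell
  rw [if_neg hnot, sub_zero, hk, htrip]
  exact payer_allOne _ ta


/-- In `K.isolate x` the member count ignores the colour of `x` (update version). [this work] -/
theorem cntM_isolate_update (K : MGraph V) (x : V) (σ : V → Fin 3) (c d : Fin 3) :
    (K.isolate x).cntM (Function.update σ x c) d = (K.isolate x).cntM σ d := by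
  unfold cntM isolate
  simp only
  congr 1
  · refine sum_congr rfl fun a _ => sum_congr rfl fun b _ => ?_
    by_cases hab : a = x ∨ b = x
    · simp [hab]
    · push Not at hab
      rw [Function.update_of_ne hab.1, Function.update_of_ne hab.2]
  · refine sum_congr rfl fun a _ => ?_
    by_cases ha : a = x
    · simp [ha]
    · rw [Function.update_of_ne ha]

/-- **Payer P4**: for a D4 cell (`S ≡ 0` except one simply-joined `s₀ ↦ 2`, `mul y v = 0`, type `010` in `K − y`), the SIBLING cell `ρ[s₀ ↦ 1]` has residual `2`.
[this work] -/
theorem resCell_sibling_of_D4 (hS : ∀ w, w ∈ S ↔ (w ≠ u ∧ w ≠ v ∧ w ≠ y ∧ K.mul y w ≠ 0)) (huv : u ≠ v) (hyu : y ≠ u) (hyv : y ≠ v)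
    (hmy : K.mark y = 0) (hyu' : K.mul y u ≠ 0) (htwo : 2 ≤ S.card) (ρ : V → Fin 3) (hu : ρ u = 0) (hv : ρ v = 1)
    {s₀ : V} (hs₀ : s₀ ∈ S) (hc₀ : ρ s₀ = 2) (hm₀ : K.mul y s₀ = 1) (hrest : ∀ s ∈ S, s ≠ s₀ → ρ s = 0) (hyv' : K.mul y v = 0)
    (ht : (K.isolate y).ctypeM ρ = (0, 1, 0)) :
    K.resCell y S (Function.update ρ s₀ 1) = 2 := by
  set ρ' := Function.update ρ s₀ 1 with hρ'
  obtain ⟨hs₀u, hs₀v, hs₀y, -⟩ := (hS s₀).1 hs₀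
  have hu' : ρ' u = 0 := by rw [hρ', Function.update_of_ne hs₀u.symm, hu]
  have hv' : ρ' v = 1 := by rw [hρ', Function.update_of_ne hs₀v.symm, hv]
  have hs' : ρ' s₀ = 1 := by rw [hρ', Function.update_self]
  have hrest' : ∀ s ∈ S, s ≠ s₀ → ρ' s = 0 := fun s hs hss => by rw [hρ', Function.update_of_ne hss, hrest s hs hss]
  -- type of ρ' in K' = K.isolate y via the splitting at s₀
  unfold ctypeM at ht
  simp only [Prod.mk.injEq] at ht
  obtain ⟨h0, h1, h2⟩ := ht
  have c0 : (K.isolate y).cntM ρ 0 = 0 := (eq_zero_iff_cap3 _).2 h0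
  have c1 : (K.isolate y).cntM ρ 1 = 1 := (eq_one_iff_cap3 _).2 h1
  have c2 : (K.isolate y).cntM ρ 2 = 0 := (eq_zero_iff_cap3 _).2 h2
  have sp0 := (K.isolate y).cntM_eq_isolate_add s₀ ρ 0
  have sp1 := (K.isolate y).cntM_eq_isolate_add s₀ ρ 1
  have sp2 := (K.isolate y).cntM_eq_isolate_add s₀ ρ 2
  have sp0' := (K.isolate y).cntM_eq_isolate_add s₀ ρ' 0
  have sp1' := (K.isolate y).cntM_eq_isolate_add s₀ ρ' 1
  have sp2' := (K.isolate y).cntM_eq_isolate_add s₀ ρ' 2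
  rw [hc₀] at sp0 sp1 sp2
  rw [hs'] at sp0' sp1' sp2'
  simp only [Fin.isValue, show ((2 : Fin 3) = 0) = False by decide, show ((2 : Fin 3) = 1) = False by decide, if_false, add_zero, if_true,
    show ((1 : Fin 3) = 0) = False by decide, show ((1 : Fin 3) = 2) = False by decide] at sp0 sp1 sp2 sp0' sp1' sp2'
  have b0 := cntM_isolate_update (K.isolate y) s₀ ρ 1 0
  have b1 := cntM_isolate_update (K.isolate y) s₀ ρ 1 1
  have b2 := cntM_isolate_update (K.isolate y) s₀ ρ 1 2
  rw [← hρ'] at b0 b1 b2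
  have n0 : (K.isolate y).cntM ρ' 0 = 0 := by rw [sp0', b0, ← sp0, c0]
  have n2 : (K.isolate y).cntM ρ' 2 = 0 := by rw [sp2', b2]; omega
  have n1 : (K.isolate y).cntM ρ' 1 ≠ 0 := by rw [sp1', b1, ← sp1, c1]; omega
  have tb : cap3 ((K.isolate y).cntM ρ' 1) ≠ 0 := fun h => n1 ((eq_zero_iff_cap3 _).2 h)
  have htrip : (K.isolate y).ctypeM ρ' = (0, cap3 ((K.isolate y).cntM ρ' 1), 0) := by
    unfold ctypeM; rw [(eq_zero_iff_cap3 _).1 n0, (eq_zero_iff_cap3 _).1 n2]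
  -- profile of ρ'
  obtain ⟨s₁, hs₁, hs₁ne⟩ : ∃ s₁ ∈ S, s₁ ≠ s₀ := by
    by_contra hno; push Not at hno
    have : S.card ≤ 1 := card_le_one.2 fun a ha b hb => by rw [hno a ha, hno b hb]
    omega
  have hA0 : 1 ≤ ∑ s ∈ S, (if ρ' s = 0 then K.mul y s else 0) := by
    have := single_le_sum (f := fun s => if ρ' s = 0 then K.mul y s else 0) (fun s _ => Nat.zero_le _) hs₁
    simp only [hrest' s₁ hs₁ hs₁ne, if_true] at this
    have := Nat.one_le_iff_ne_zero.2 ((hS s₁).1 hs₁).2.2.2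
    omega
  have hA1 : (∑ s ∈ S, (if ρ' s = 1 then K.mul y s else 0)) = 1 := by
    rw [sum_eq_single_of_mem s₀ hs₀ (fun s hs hss => by rw [hrest' s hs hss]; simp), if_pos hs', hm₀]
  have hA2 : (∑ s ∈ S, (if ρ' s = 2 then K.mul y s else 0)) = 0 :=
    sum_eq_zero fun s hs => by
      by_cases hss : s = s₀
      · rw [hss, hs']; simp
      · rw [hrest' s hs hss]; simp
  have hk : K.profM y ρ' = (2, 1, 0) := by
    unfold profM
    simp only [hmy, add_zero]
    rw [linkM_eq_outer hS huv hyu hyv ρ' 0, linkM_eq_outer hS huv hyu hyv ρ' 1, linkM_eq_outer hS huv hyu hyv ρ' 2,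
      if_pos hu', if_neg (by rw [hv']; decide), if_neg (by rw [hu']; decide), if_pos hv', if_neg (by rw [hu']; decide), if_neg (by rw [hv']; decide),
      hA1, hA2, hyv']
    have hmu : 1 ≤ K.mul y u := Nat.one_le_iff_ne_zero.2 hyu'
    refine Prod.ext ?_ (Prod.ext ?_ ?_)
    · simp only [add_zero]; exact (two_le_iff_cap3 _).1 (by omega)
    · rfl
    · rfl
  have hnot : ¬(∀ s ∈ S, ρ' s = 0) := fun hh => by have := hh s₀ hs₀; rw [hs'] at this; exact absurd this (by decide)
  unfold resCell
  rw [if_neg hnot, sub_zero, hk, htrip]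
  exact payer_sibling _ tb


/-- **Payer P5**: for a D5 cell (`S ≡ 0` except one simply-joined `s₀ ↦ 1`, `mul y v = 0`, type `001` in `K − y`), the cell `(Φ_u ρ)[s₀ ↦ 0]`
(all of `S` coloured `2` except `s₀ ↦ 0`) has residual `≥ 1` (`= 2` when `|S| ≥ 3`). [this work] -/
theorem one_le_resCell_partner_of_D5 (hS : ∀ w, w ∈ S ↔ (w ≠ u ∧ w ≠ v ∧ w ≠ y ∧ K.mul y w ≠ 0)) (huv : u ≠ v) (hyu : y ≠ u) (hyv : y ≠ v)
    (hmy : K.mark y = 0) (hyu' : K.mul y u ≠ 0) (htwo : 2 ≤ S.card) (ρ : V → Fin 3) (hu : ρ u = 0) (hv : ρ v = 1)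
    {s₀ : V} (hs₀ : s₀ ∈ S) (hc₀ : ρ s₀ = 1) (hm₀ : K.mul y s₀ = 1) (hrest : ∀ s ∈ S, s ≠ s₀ → ρ s = 0) (hyv' : K.mul y v = 0)
    (ht : (K.isolate y).ctypeM ρ = (0, 0, 1)) :
    1 ≤ K.resCell y S (Function.update (phiU u ρ) s₀ 0) := by
  set φ := phiU u ρ with hφ
  set ρ' := Function.update φ s₀ 0 with hρ'
  obtain ⟨hs₀u, hs₀v, hs₀y, -⟩ := (hS s₀).1 hs₀
  have huS : u ∉ S := fun h => ((hS u).1 h).1 rfl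
  have hφu : φ u = 0 := by rw [hφ, phiU_self, hu]
  have hφv : φ v = 1 := by rw [hφ, phiU_of_ne u ρ huv.symm, hv]; decide
  have hφs : φ s₀ = 1 := by rw [hφ, phiU_of_ne u ρ hs₀u, hc₀]; decide
  have hφrest : ∀ s ∈ S, s ≠ s₀ → φ s = 2 := fun s hs hss => by
    rw [hφ, phiU_of_ne u ρ (fun h => huS (h ▸ hs)), hrest s hs hss]; decide
  have hu' : ρ' u = 0 := by rw [hρ', Function.update_of_ne hs₀u.symm, hφu]
  have hv' : ρ' v = 1 := by rw [hρ', Function.update_of_ne hs₀v.symm, hφv]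
  have hs' : ρ' s₀ = 0 := by rw [hρ', Function.update_self]
  have hrest' : ∀ s ∈ S, s ≠ s₀ → ρ' s = 2 := fun s hs hss => by rw [hρ', Function.update_of_ne hss, hφrest s hs hss]
  -- type of φ in K' (swap identities), then of ρ' (splitting at s₀)
  obtain ⟨tb, tc, ta⟩ := ctypeM_isolate_phiU_of_001 ρ hu ht
  rw [← hφ] at tb tc ta
  unfold ctypeM at tb tc ta
  simp only at tb tc ta
  have f1 : (K.isolate y).cntM φ 1 = 0 := (eq_zero_iff_cap3 _).2 tb
  have f2 : (K.isolate y).cntM φ 2 = 0 := (eq_zero_iff_cap3 _).2 tc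
  have f0 : (K.isolate y).cntM φ 0 ≠ 0 := fun h => ta ((eq_zero_iff_cap3 _).1 h)
  have sp0 := (K.isolate y).cntM_eq_isolate_add s₀ φ 0
  have sp1 := (K.isolate y).cntM_eq_isolate_add s₀ φ 1
  have sp2 := (K.isolate y).cntM_eq_isolate_add s₀ φ 2
  have sp0' := (K.isolate y).cntM_eq_isolate_add s₀ ρ' 0
  have sp1' := (K.isolate y).cntM_eq_isolate_add s₀ ρ' 1
  have sp2' := (K.isolate y).cntM_eq_isolate_add s₀ ρ' 2
  rw [hφs] at sp0 sp1 sp2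
  rw [hs'] at sp0' sp1' sp2'
  simp only [Fin.isValue, show ((1 : Fin 3) = 0) = False by decide, show ((1 : Fin 3) = 2) = False by decide, if_false, add_zero, if_true,
    show ((0 : Fin 3) = 1) = False by decide, show ((0 : Fin 3) = 2) = False by decide] at sp0 sp1 sp2 sp0' sp1' sp2'
  have b0 := cntM_isolate_update (K.isolate y) s₀ φ 0 0
  have b1 := cntM_isolate_update (K.isolate y) s₀ φ 0 1
  have b2 := cntM_isolate_update (K.isolate y) s₀ φ 0 2
  rw [← hρ'] at b0 b1 b2
  have n1 : (K.isolate y).cntM ρ' 1 = 0 := by rw [sp1', b1]; omega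
  have n2 : (K.isolate y).cntM ρ' 2 = 0 := by rw [sp2', b2, ← sp2, f2]
  have n0 : (K.isolate y).cntM ρ' 0 ≠ 0 := by rw [sp0', b0]; omega
  have ta' : cap3 ((K.isolate y).cntM ρ' 0) ≠ 0 := fun h => n0 ((eq_zero_iff_cap3 _).2 h)
  have htrip : (K.isolate y).ctypeM ρ' = (cap3 ((K.isolate y).cntM ρ' 0), 0, 0) := by
    unfold ctypeM; rw [(eq_zero_iff_cap3 _).1 n1, (eq_zero_iff_cap3 _).1 n2]
  -- profile of ρ'
  obtain ⟨s₁, hs₁, hs₁ne⟩ : ∃ s₁ ∈ S, s₁ ≠ s₀ := by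
    by_contra hno; push Not at hno
    have : S.card ≤ 1 := card_le_one.2 fun a ha b hb => by rw [hno a ha, hno b hb]
    omega
  have hA0 : (∑ s ∈ S, (if ρ' s = 0 then K.mul y s else 0)) = 1 := by
    rw [sum_eq_single_of_mem s₀ hs₀ (fun s hs hss => by rw [hrest' s hs hss]; simp), if_pos hs', hm₀]
  have hA1 : (∑ s ∈ S, (if ρ' s = 1 then K.mul y s else 0)) = 0 :=
    sum_eq_zero fun s hs => by
      by_cases hss : s = s₀
      · rw [hss, hs']; simp
      · rw [hrest' s hs hss]; simp
  have hA2 : (∑ s ∈ S, (if ρ' s = 2 then K.mul y s else 0)) ≠ 0 := by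
    have := single_le_sum (f := fun s => if ρ' s = 2 then K.mul y s else 0) (fun s _ => Nat.zero_le _) hs₁
    simp only [hrest' s₁ hs₁ hs₁ne, if_true] at this
    have := Nat.one_le_iff_ne_zero.2 ((hS s₁).1 hs₁).2.2.2
    omega
  have hk : K.profM y ρ' = (2, 0, cap3 (∑ s ∈ S, (if ρ' s = 2 then K.mul y s else 0))) := by
    unfold profM
    simp only [hmy, add_zero]
    rw [linkM_eq_outer hS huv hyu hyv ρ' 0, linkM_eq_outer hS huv hyu hyv ρ' 1, linkM_eq_outer hS huv hyu hyv ρ' 2,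
      if_pos hu', if_neg (by rw [hv']; decide), if_neg (by rw [hu']; decide), if_pos hv', if_neg (by rw [hu']; decide), if_neg (by rw [hv']; decide),
      hA0, hA1, hyv']
    have hmu : 1 ≤ K.mul y u := Nat.one_le_iff_ne_zero.2 hyu'
    refine Prod.ext ?_ (Prod.ext ?_ ?_)
    · simp only; exact (two_le_iff_cap3 _).1 (by omega)
    · rfl
    · simp only [zero_add]
  have hkc : cap3 (∑ s ∈ S, (if ρ' s = 2 then K.mul y s else 0)) ≠ 0 := fun h => hA2 ((eq_zero_iff_cap3 _).2 h)
  have hnot : ¬(∀ s ∈ S, ρ' s = 0) := fun hh => by have := hh s₁ hs₁; rw [hrest' s₁ hs₁ hs₁ne] at this; exact absurd this (by decide)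
  unfold resCell
  rw [if_neg hnot, sub_zero, hk, htrip]
  exact one_le_kerTAbs_two_zero_pos _ _ ta' hkc


end Charging

end MGraph

end Summit.CriticalPhenomena.PercolationContinuityZ3.Theorems.SunflowerPartition.Kempe
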